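import Summits.AtomisticToContinuum.BoseEinsteinCondensation.Theorems.BECInfraredBoundBecUvTailCutoff
import Summits.AtomisticToContinuum.BoseEinsteinCondensation.Theorems.BECInfraredBoundBecUvTailCollarMass
import Literature.MathematicalPhysics.QuantumManyBody.CellProjectionTail
import HarnessLib

/-!
# `BecUvTail` (stmt-AtomisticToContinuum-8823), line `Sketch` — registered stub `stub_oneBodyTail`

Helper for the crux skeleton `Cruxes/BecUvTail/Lines/Sketch.lean` of route `BECInfraredBound`
(`AtomisticToContinuum/BoseEinsteinCondensation`): proves the registered stub `stub_oneBodyTail`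
verbatim — the ONE-BODY ULTRAVIOLET TAIL INEQUALITY on the periodic cell `[0,ℓ)³`: there are absolute
constants `0 ≤ c₀ < 1`, `A ≥ 0`, `M ≥ 1` such that for every `ℓ > 0`, `K' ≥ M` and `u ∈ C¹(ℝ³)`,
`ℓ³ Σ_{‖n‖∞ > K'} |ĉ_n(u)|² ≤ c₀ ∫_{[0,ℓ)³}|u|² + A(ℓ/K')² ∫_{[0,ℓ)³}|∇u|²`
(`ĉ_n = cellFourierCoeff ℓ u n`, sup norm on `n ∈ ℤ³`). Proof (collar cut-off): with `s = ℓ/K'` and the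
`C¹` product cut-off `χ` of `stub_cutoff` (`= 1` on `[s,ℓ−s]³`, `tsupport χ ⊆ cell`, `|∂_jχ| ≤ 2π/s`),
split `u = χu + (1−χ)u`; the tail of `χu` is paid by the legal kinetic Chebyshev bound of the tree
(`tsum_sq_grad_cellFourierCoeff_of_support`: `≤ (ℓ/2πK')²∫|∇(χu)|²`, and
`|∇(χu)|² ≤ 2|∇u|² + 24π²s⁻²·1_{collar}|u|²`), the whole of `(1−χ)u` by Parseval
(`tsum_sq_cellFourierCoeff`: `≤ ∫_{collar}|u|²`), and the collar mass by `stub_collarMass`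
(`≤ (12/M')∫|u|² + 4(M'+1)s²∫|∇u|²`, `M' = 336`), giving `c₀ = 1/2`, `A = π⁻² + 56·337`, `M = 337`.
Elementary Fourier analysis; tagged folklore (the variational set-up is [LSSY2005, Ch. 2, Ch. 5]).
-/

noncomputable section

open MeasureTheory Filter Set
open scoped ENNReal NNReal BigOperators ComplexConjugate

namespace Summit.AtomisticToContinuum.BoseEinsteinCondensation.Theorems.BecUvTail

open Literature.MathematicalPhysics.QuantumManyBody.BoseGas

/-! ### Small algebraic lemmas -/

/-- `‖a + b‖₊² ≤ 2‖a‖₊² + 2‖b‖₊²` in `ℝ≥0∞`. [folklore] -/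
private theorem ennnorm_add_sq_le {E : Type*} [SeminormedAddCommGroup E] (a b : E) :
    ((‖a + b‖₊ : ℝ≥0∞) ^ 2) ≤ 2 * (‖a‖₊ : ℝ≥0∞) ^ 2 + 2 * (‖b‖₊ : ℝ≥0∞) ^ 2 := by
  have h : (‖a + b‖₊ : ℝ≥0∞) ≤ ‖a‖₊ + ‖b‖₊ := by exact_mod_cast nnnorm_add_le a b
  calc ((‖a + b‖₊ : ℝ≥0∞) ^ 2) ≤ ((‖a‖₊ : ℝ≥0∞) + ‖b‖₊) ^ 2 := pow_le_pow_left' h 2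
    _ ≤ 2 * (‖a‖₊ : ℝ≥0∞) ^ 2 + 2 * (‖b‖₊ : ℝ≥0∞) ^ 2 := by
        have : ∀ p q : ℝ≥0∞, (p + q) ^ 2 ≤ 2 * p ^ 2 + 2 * q ^ 2 := by
          intro p q
          rcases eq_or_ne p ⊤ with rfl | hp
          · simp
          rcases eq_or_ne q ⊤ with rfl | hq
          · simp
          lift p to ℝ≥0 using hp
          lift q to ℝ≥0 using hq
          have h2 : (p + q : ℝ≥0) ^ 2 ≤ 2 * p ^ 2 + 2 * q ^ 2 :=
            calc (p + q : ℝ≥0) ^ 2 = p ^ 2 + 2 * p * q + q ^ 2 := add_sq p q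
              _ ≤ p ^ 2 + (p ^ 2 + q ^ 2) + q ^ 2 := by gcongr; exact two_mul_le_add_sq p q
              _ = 2 * p ^ 2 + 2 * q ^ 2 := by ring
          exact_mod_cast h2
        exact this _ _

/-- For `v : Fin 3 → ℝ` and `0 ≤ K' < ‖v‖` (sup norm) some coordinate exceeds `K'` in absolute
value, hence `K'² ≤ Σⱼ vⱼ²`; in the form `1 ≤ (Σⱼ vⱼ²)/K'²` for `0 < K'`. [folklore] -/
private theorem one_le_sum_sq_div {K' : ℝ} (hK : 0 < K') {v : Fin 3 → ℝ} (hv : K' < ‖v‖) :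
    1 ≤ (∑ j, v j ^ 2) / K' ^ 2 := by
  have hex : ∃ j, K' < |v j| := by
    by_contra h
    push Not at h
    have : ‖v‖ ≤ K' := (pi_norm_le_iff_of_nonneg hK.le).2 fun j => by
      rw [Real.norm_eq_abs]; exact h j
    exact absurd hv (not_lt.2 this)
  obtain ⟨j, hj⟩ := hex
  rw [le_div_iff₀ (by positivity), one_mul]
  have h1 : K' ^ 2 ≤ v j ^ 2 := by
    rw [← sq_abs (v j)]
    exact pow_le_pow_left₀ hK.le hj.le 2
  exact h1.trans (Finset.single_le_sum (f := fun i => v i ^ 2) (fun i _ => sq_nonneg _)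
    (Finset.mem_univ j))


/-! ### Fourier coefficients: linearity and the tail comparison -/

/-- `ĉ_n(φ + ψ) = ĉ_n(φ) + ĉ_n(ψ)` for continuous `φ, ψ` (linearity of the cell integral). [folklore] -/
private theorem cellFourierCoeff_add {ℓ : ℝ} (hℓ : 0 < ℓ) {φ ψ : Space → ℂ} (hφ : Continuous φ)
    (hψ : Continuous ψ) (n : Fin 3 → ℤ) :
    cellFourierCoeff ℓ (fun x => φ x + ψ x) n = cellFourierCoeff ℓ φ n + cellFourierCoeff ℓ ψ n := by
  have hw : Continuous fun x => conj (cellWave ℓ n x) :=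
    Complex.continuous_conj.comp (contDiff_cellWave ℓ n).continuous
  have h1 : IntegrableOn (fun x => conj (cellWave ℓ n x) * φ x) (cell ℓ) volume :=
    integrableOn_cell (hw.mul hφ)
  have h2 : IntegrableOn (fun x => conj (cellWave ℓ n x) * ψ x) (cell ℓ) volume :=
    integrableOn_cell (hw.mul hψ)
  simp only [cellFourierCoeff_eq_integral hℓ]
  rw [← smul_add]
  congr 1
  exact (setIntegral_congr_fun (measurableSet_cell ℓ) (fun x _ => by ring)).trans
    (integral_add h1 h2)

/-- The tail sum is dominated by the `|n|²/K'²`-weighted full sum: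
`Σ_{‖n‖∞ > K'} g n ≤ Σ_n (Σⱼnⱼ²/K'²) g n`. [folklore] -/
private theorem tsum_tail_le_tsum_weight {K' : ℝ} (hK : 0 < K') (g : (Fin 3 → ℤ) → ℝ≥0∞) :
    ∑' n : {n : Fin 3 → ℤ // K' < ‖(fun j => (n j : ℝ))‖}, g (n : Fin 3 → ℤ) ≤
      ∑' n : Fin 3 → ℤ, ENNReal.ofReal ((∑ j, (n j : ℝ) ^ 2) / K' ^ 2) * g n := by
  calc ∑' n : {n : Fin 3 → ℤ // K' < ‖(fun j => (n j : ℝ))‖}, g (n : Fin 3 → ℤ)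
      ≤ ∑' n : {n : Fin 3 → ℤ // K' < ‖(fun j => (n j : ℝ))‖},
          ENNReal.ofReal ((∑ j, ((n : Fin 3 → ℤ) j : ℝ) ^ 2) / K' ^ 2) * g (n : Fin 3 → ℤ) := by
        refine ENNReal.tsum_le_tsum fun n => ?_
        have h1 : 1 ≤ ENNReal.ofReal ((∑ j, ((n : Fin 3 → ℤ) j : ℝ) ^ 2) / K' ^ 2) :=
          ENNReal.one_le_ofReal.2 (one_le_sum_sq_div hK n.2)
        calc g (n : Fin 3 → ℤ) = 1 * g (n : Fin 3 → ℤ) := (one_mul _).symm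
          _ ≤ _ := mul_le_mul_left h1 _
    _ ≤ ∑' n : Fin 3 → ℤ, ENNReal.ofReal ((∑ j, (n j : ℝ) ^ 2) / K' ^ 2) * g n :=
        ENNReal.tsum_comp_le_tsum_of_injective Subtype.val_injective
          (fun n : Fin 3 → ℤ => ENNReal.ofReal ((∑ j, (n j : ℝ) ^ 2) / K' ^ 2) * g n)

/-! ### The cut-off product: derivative and pointwise bounds -/

/-- Product rule for a real `C¹` cut-off times a complex `C¹` function, in direction `v`:
`∂_v(χu)(x) = χ(x) ∂_v u(x) + ∂_vχ(x) u(x)`. [folklore] -/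
private theorem fderiv_cut_smul {χ : Space → ℝ} {u : Space → ℂ} (hχ : Differentiable ℝ χ)
    (hu : Differentiable ℝ u) (x v : Space) :
    fderiv ℝ (fun y => χ y • u y) x v = χ x • fderiv ℝ u x v + fderiv ℝ χ x v • u x := by
  rw [((hχ x).hasFDerivAt.fun_smul (hu x).hasFDerivAt).fderiv]
  rfl

/-- `|∂_v(χu)|² ≤ 2|∂_v u|² + 2|∂_vχ|²|u|²` for a cut-off with values in `[0,1]`. [folklore] -/
private theorem ennnorm_sq_fderiv_cut_smul_le {χ : Space → ℝ} {u : Space → ℂ}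
    (hχ : Differentiable ℝ χ) (hu : Differentiable ℝ u) (h01 : ∀ y, 0 ≤ χ y ∧ χ y ≤ 1)
    (x v : Space) :
    ((‖fderiv ℝ (fun y => χ y • u y) x v‖₊ : ℝ≥0∞) ^ 2) ≤
      2 * (‖fderiv ℝ u x v‖₊ : ℝ≥0∞) ^ 2 +
        2 * (ENNReal.ofReal (|fderiv ℝ χ x v| ^ 2) * (‖u x‖₊ : ℝ≥0∞) ^ 2) := by
  rw [fderiv_cut_smul hχ hu]
  refine (ennnorm_add_sq_le _ _).trans (add_le_add ?_ ?_)
  · refine mul_le_mul_right (pow_le_pow_left' ?_ 2) _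
    have h : ‖χ x • fderiv ℝ u x v‖₊ ≤ ‖fderiv ℝ u x v‖₊ := by
      rw [nnnorm_smul]
      refine mul_le_of_le_one_left bot_le ?_
      rw [← NNReal.coe_le_coe, coe_nnnorm, Real.norm_eq_abs, NNReal.coe_one,
        abs_le]
      exact ⟨by linarith [(h01 x).1], (h01 x).2⟩
    exact_mod_cast h
  · refine mul_le_mul_right (le_of_eq ?_) _
    rw [nnnorm_smul, ENNReal.coe_mul, mul_pow, coe_nnnorm_sq_eq_ofReal (fderiv ℝ χ x v),
      Real.norm_eq_abs]

/-- `|∇f|²` is measurable for any `f : ℝ³ → ℂ`. [folklore] -/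
private theorem measurable_gradSqC' (f : Space → ℂ) : Measurable (gradSqC f) := by
  refine Finset.measurable_sum _ fun k _ => ?_
  exact ((measurable_fderiv_apply_const ℝ f _).nnnorm.coe_nnreal_ennreal).pow_const _

/-- The sets of the collar decomposition are measurable. [folklore] -/
private theorem measurableSet_inner (ℓ s : ℝ) :
    MeasurableSet {x : Space | ∀ j, x j ∈ Set.Icc s (ℓ - s)} := by
  have : {x : Space | ∀ j, x j ∈ Set.Icc s (ℓ - s)} = ⋂ j, (fun x : Space => x j) ⁻¹' Set.Icc s (ℓ - s) := by
    ext x; simp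
  rw [this]
  exact MeasurableSet.iInter fun j => measurableSet_Icc.preimage (by fun_prop)

/-- **Kinetic energy of the cut-off product.** With `χ` the cut-off of `stub_cutoff` (`= 1` and
`∇χ = 0` on the inner cube, `tsupport χ ⊆ cell`, `|∂ⱼχ| ≤ 2π/s`):
`∫_cell |∇(χu)|² ≤ 2∫_cell |∇u|² + 2·(12π²/s²) ∫_{cell ∖ inner} |u|²`. [folklore] -/
private theorem lintegral_gradSqC_cut_le {ℓ s : ℝ} {χ : Space → ℝ} {u : Space → ℂ}
    (hχ : ContDiff ℝ 1 χ) (hsupp : tsupport χ ⊆ cell ℓ) (h01 : ∀ y, 0 ≤ χ y ∧ χ y ≤ 1)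
    (hD : ∀ (x : Space) (j : Fin 3), |fderiv ℝ χ x (EuclideanSpace.single j 1)| ≤ 2 * Real.pi / s)
    (hin : ∀ x : Space, (∀ j, x j ∈ Set.Icc s (ℓ - s)) → ∀ j : Fin 3,
      fderiv ℝ χ x (EuclideanSpace.single j 1) = 0)
    (hu : ContDiff ℝ 1 u) :
    ∫⁻ x in cell ℓ, gradSqC (fun y => χ y • u y) x ≤
      2 * (∫⁻ x in cell ℓ, gradSqC u x) + 2 * (ENNReal.ofReal (12 * Real.pi ^ 2 / s ^ 2) *
        ∫⁻ x in cell ℓ \ {x : Space | ∀ j, x j ∈ Set.Icc s (ℓ - s)}, (‖u x‖₊ : ℝ≥0∞) ^ 2) := by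
  set inner : Set Space := {x : Space | ∀ j, x j ∈ Set.Icc s (ℓ - s)} with hinner
  have hχd : Differentiable ℝ χ := hχ.differentiable one_ne_zero
  have hud : Differentiable ℝ u := hu.differentiable one_ne_zero
  -- pointwise: each direction
  have hdir : ∀ (x : Space) (j : Fin 3),
      ENNReal.ofReal (|fderiv ℝ χ x (EuclideanSpace.single j 1)| ^ 2) * (‖u x‖₊ : ℝ≥0∞) ^ 2 ≤
        ENNReal.ofReal ((2 * Real.pi / s) ^ 2) *
          (cell ℓ \ inner).indicator (fun y => (‖u y‖₊ : ℝ≥0∞) ^ 2) x := by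
    intro x j
    by_cases hx : x ∈ cell ℓ \ inner
    · rw [Set.indicator_of_mem hx]
      refine mul_le_mul_left (ENNReal.ofReal_le_ofReal ?_) _
      exact pow_le_pow_left₀ (abs_nonneg _) (hD x j) 2
    · have h0 : fderiv ℝ χ x (EuclideanSpace.single j 1) = 0 := by
        rw [Set.mem_sdiff, not_and_or, not_not] at hx
        rcases hx with hx | hx
        · rw [fderiv_of_notMem_tsupport ℝ (fun h => hx (hsupp h))]; rfl
        · exact hin x hx j
      rw [h0]
      simp
  have hpt : ∀ x : Space, gradSqC (fun y => χ y • u y) x ≤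
      2 * gradSqC u x + 2 * (ENNReal.ofReal (12 * Real.pi ^ 2 / s ^ 2) *
        (cell ℓ \ inner).indicator (fun y => (‖u y‖₊ : ℝ≥0∞) ^ 2) x) := by
    intro x
    have h12 : ENNReal.ofReal (12 * Real.pi ^ 2 / s ^ 2) = 3 * ENNReal.ofReal ((2 * Real.pi / s) ^ 2) := by
      rw [show (3 : ℝ≥0∞) = ENNReal.ofReal 3 by norm_num, ← ENNReal.ofReal_mul (by norm_num)]
      congr 1; ring
    calc gradSqC (fun y => χ y • u y) x
        = ∑ j : Fin 3, ((‖fderiv ℝ (fun y => χ y • u y) x (EuclideanSpace.single j 1)‖₊ : ℝ≥0∞) ^ 2) := rfl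
      _ ≤ ∑ j : Fin 3, (2 * (‖fderiv ℝ u x (EuclideanSpace.single j 1)‖₊ : ℝ≥0∞) ^ 2 +
            2 * (ENNReal.ofReal ((2 * Real.pi / s) ^ 2) *
              (cell ℓ \ inner).indicator (fun y => (‖u y‖₊ : ℝ≥0∞) ^ 2) x)) :=
          Finset.sum_le_sum fun j _ => (ennnorm_sq_fderiv_cut_smul_le hχd hud h01 x _).trans
            (add_le_add le_rfl (mul_le_mul_right (hdir x j) _))
      _ = 2 * gradSqC u x + 2 * (ENNReal.ofReal (12 * Real.pi ^ 2 / s ^ 2) *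
            (cell ℓ \ inner).indicator (fun y => (‖u y‖₊ : ℝ≥0∞) ^ 2) x) := by
          rw [h12, gradSqC, Fin.sum_univ_three, Fin.sum_univ_three]
          ring
  -- integrate
  have hmeas_ind : Measurable fun x => (cell ℓ \ inner).indicator (fun y => (‖u y‖₊ : ℝ≥0∞) ^ 2) x :=
    (hu.continuous.measurable.nnnorm.coe_nnreal_ennreal.pow_const 2).indicator
      ((measurableSet_cell ℓ).diff (measurableSet_inner ℓ s))
  calc ∫⁻ x in cell ℓ, gradSqC (fun y => χ y • u y) x
      ≤ ∫⁻ x in cell ℓ, (2 * gradSqC u x + 2 * (ENNReal.ofReal (12 * Real.pi ^ 2 / s ^ 2) *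
          (cell ℓ \ inner).indicator (fun y => (‖u y‖₊ : ℝ≥0∞) ^ 2) x)) := lintegral_mono hpt
    _ = 2 * (∫⁻ x in cell ℓ, gradSqC u x) + 2 * (ENNReal.ofReal (12 * Real.pi ^ 2 / s ^ 2) *
          ∫⁻ x in cell ℓ, (cell ℓ \ inner).indicator (fun y => (‖u y‖₊ : ℝ≥0∞) ^ 2) x) := by
        rw [lintegral_add_left ((measurable_gradSqC' u).const_mul 2), lintegral_const_mul _
          (measurable_gradSqC' u), lintegral_const_mul _ (hmeas_ind.const_mul _),
          lintegral_const_mul _ hmeas_ind]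
    _ = _ := by
        rw [setLIntegral_indicator ((measurableSet_cell ℓ).diff (measurableSet_inner ℓ s)),
          Set.inter_eq_left.2 Set.sdiff_subset]

/-- **Mass of the complementary piece**: `∫_cell |(1-χ)u|² ≤ ∫_{cell ∖ inner} |u|²` (`1 - χ ∈ [0,1]`
vanishes on the inner cube). [folklore] -/
private theorem lintegral_sq_compl_cut_le {ℓ s : ℝ} {χ : Space → ℝ} {u : Space → ℂ}
    (h01 : ∀ y, 0 ≤ χ y ∧ χ y ≤ 1)
    (h1 : ∀ x : Space, (∀ j, x j ∈ Set.Icc s (ℓ - s)) → χ x = 1) :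
    ∫⁻ x in cell ℓ, (‖(1 - χ x) • u x‖₊ : ℝ≥0∞) ^ 2 ≤
      ∫⁻ x in cell ℓ \ {x : Space | ∀ j, x j ∈ Set.Icc s (ℓ - s)}, (‖u x‖₊ : ℝ≥0∞) ^ 2 := by
  set inner : Set Space := {x : Space | ∀ j, x j ∈ Set.Icc s (ℓ - s)} with hinner
  have hpt : ∀ x ∈ cell ℓ, ((‖(1 - χ x) • u x‖₊ : ℝ≥0∞) ^ 2) ≤
      (cell ℓ \ inner).indicator (fun y => (‖u y‖₊ : ℝ≥0∞) ^ 2) x := by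
    intro x hx
    by_cases hxi : x ∈ inner
    · rw [h1 x hxi, sub_self, zero_smul]
      simp
    · rw [Set.indicator_of_mem (show x ∈ cell ℓ \ inner from ⟨hx, hxi⟩)]
      refine pow_le_pow_left' ?_ 2
      have h : ‖(1 - χ x) • u x‖₊ ≤ ‖u x‖₊ := by
        rw [nnnorm_smul]
        refine mul_le_of_le_one_left bot_le ?_
        rw [← NNReal.coe_le_coe, coe_nnnorm, Real.norm_eq_abs, NNReal.coe_one, abs_le]
        exact ⟨by linarith [(h01 x).2], by linarith [(h01 x).1]⟩
      exact_mod_cast h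
  calc ∫⁻ x in cell ℓ, (‖(1 - χ x) • u x‖₊ : ℝ≥0∞) ^ 2
      ≤ ∫⁻ x in cell ℓ, (cell ℓ \ inner).indicator (fun y => (‖u y‖₊ : ℝ≥0∞) ^ 2) x :=
        setLIntegral_mono' (measurableSet_cell ℓ) hpt
    _ = _ := by
        rw [setLIntegral_indicator ((measurableSet_cell ℓ).diff (measurableSet_inner ℓ s)),
          Set.inter_eq_left.2 Set.sdiff_subset]


/-! ### The one-body ultraviolet tail inequality -/

/-- **The one-body ultraviolet tail inequality on the cell** (registered stub `stub_oneBodyTail` of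
stmt-AtomisticToContinuum-8823, verbatim): there are absolute constants `0 ≤ c₀ < 1`, `A ≥ 0`,
`M ≥ 1` (namely `c₀ = 1/2`, `A = π⁻² + 56·337`, `M = 337`) such that for every `ℓ > 0`, `K' ≥ M`
and `u ∈ C¹(ℝ³)`, `ℓ³ Σ_{‖n‖∞ > K'} |ĉ_n(u)|² ≤ c₀ ∫_{[0,ℓ)³}|u|² + A(ℓ/K')² ∫_{[0,ℓ)³}|∇u|²`.
Proof: collar cut-off at margin `s = ℓ/K'` (`stub_cutoff`), `u = χu + (1−χ)u`,
`|ĉ(u)|² ≤ 2|ĉ(χu)|² + 2|ĉ((1−χ)u)|²`; the tail of `χu` by the support-Chebyshev bound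
`tsum_sq_grad_cellFourierCoeff_of_support` (weight `|n|²/K'² ≥ 1` on the tail) and
`lintegral_gradSqC_cut_le`; the whole of `(1−χ)u` by Parseval `tsum_sq_cellFourierCoeff` and
`lintegral_sq_compl_cut_le`; the collar mass by `stub_collarMass` with `M' = 336`. [folklore] -/
theorem stub_oneBodyTail :
    ∃ c₀ : ℝ, 0 ≤ c₀ ∧ c₀ < 1 ∧ ∃ A : ℝ, 0 ≤ A ∧ ∃ M : ℝ, 1 ≤ M ∧ ∀ (ℓ K' : ℝ) (u : EuclideanSpace ℝ (Fin 3) → ℂ), 0 < ℓ → M ≤ K' → ContDiff ℝ 1 u → ENNReal.ofReal ℓ ^ 3 * ∑' n : {n : Fin 3 → ℤ // K' < ‖(fun j => (n j : ℝ))‖}, (‖Literature.MathematicalPhysics.QuantumManyBody.BoseGas.cellFourierCoeff ℓ u (n : Fin 3 → ℤ)‖₊ : ENNReal) ^ 2 ≤ ENNReal.ofReal c₀ * (∫⁻ x in Literature.MathematicalPhysics.QuantumManyBody.BoseGas.cell ℓ, (‖u x‖₊ : ENNReal) ^ 2) + ENNReal.ofReal (A * (ℓ / K') ^ 2) * ∫⁻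 x in Literature.MathematicalPhysics.QuantumManyBody.BoseGas.cell ℓ, Literature.MathematicalPhysics.QuantumManyBody.BoseGas.gradSqC u x := by
  refine ⟨1 / 2, by norm_num, by norm_num, 1 / Real.pi ^ 2 + 56 * 337, by positivity, 337,
    by norm_num, ?_⟩
  intro ℓ K' u hℓ hK' hu
  -- constants and the margin
  have hK'pos : 0 < K' := lt_of_lt_of_le (by norm_num) hK'
  set s : ℝ := ℓ / K' with hs
  have hs0 : 0 < s := div_pos hℓ hK'pos
  have hsK : s * K' = ℓ := by rw [hs]; field_simp
  have h4s : 4 * s ≤ ℓ := by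
    rw [← hsK]; nlinarith
  have hroom : ((336 : ℝ) + 1) * s ≤ ℓ := by
    rw [← hsK]; nlinarith
  -- the cut-off
  obtain ⟨χ, hχ, hχcs, hχsupp, h01, h1, hD, hin⟩ := stub_cutoff ℓ s hs0 h4s
  have hχd : Differentiable ℝ χ := hχ.differentiable one_ne_zero
  have hud : Differentiable ℝ u := hu.differentiable one_ne_zero
  set φ₁ : Space → ℂ := fun y => χ y • u y with hφ₁
  set φ₂ : Space → ℂ := fun y => (1 - χ y) • u y with hφ₂
  have hφ₁C : ContDiff ℝ 1 φ₁ := hχ.smul hu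
  have hφ₂C : ContDiff ℝ 1 φ₂ := (contDiff_const.sub hχ).smul hu
  have hφ₁cs : HasCompactSupport φ₁ := hχcs.smul_right
  have hφ₁supp : tsupport φ₁ ⊆ cell ℓ := (tsupport_smul_subset_left χ u).trans hχsupp
  have hsplit : u = fun y => φ₁ y + φ₂ y := by
    funext y
    simp only [hφ₁, hφ₂, ← add_smul, add_sub_cancel, one_smul]
  -- abbreviations
  set L3 : ℝ≥0∞ := ENNReal.ofReal ℓ ^ 3 with hL3
  have hL3ne0 : L3 ≠ 0 := pow_ne_zero _ (ENNReal.ofReal_pos.2 hℓ).ne'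
  have hL3netop : L3 ≠ ⊤ := ENNReal.pow_ne_top ENNReal.ofReal_ne_top
  set KIN : ℝ≥0∞ := ∫⁻ x in cell ℓ, gradSqC u x with hKIN
  set MASS : ℝ≥0∞ := ∫⁻ x in cell ℓ, (‖u x‖₊ : ℝ≥0∞) ^ 2 with hMASS
  set COL : ℝ≥0∞ := ∫⁻ x in cell ℓ \ {x : Space | ∀ j, x j ∈ Set.Icc s (ℓ - s)},
    (‖u x‖₊ : ℝ≥0∞) ^ 2 with hCOL
  set a : ℝ := ℓ ^ 2 / (4 * Real.pi ^ 2 * K' ^ 2) with ha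
  have ha0 : 0 ≤ a := by positivity
  -- (1) splitting the coefficients
  have hcoef : ∀ n : Fin 3 → ℤ, ((‖cellFourierCoeff ℓ u n‖₊ : ℝ≥0∞) ^ 2) ≤
      2 * (‖cellFourierCoeff ℓ φ₁ n‖₊ : ℝ≥0∞) ^ 2 + 2 * (‖cellFourierCoeff ℓ φ₂ n‖₊ : ℝ≥0∞) ^ 2 := by
    intro n
    rw [hsplit, cellFourierCoeff_add hℓ hφ₁C.continuous hφ₂C.continuous]
    exact ennnorm_add_sq_le _ _
  -- (2) the tail of `χu`: support-Chebyshev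
  have hcheb := tsum_sq_grad_cellFourierCoeff_of_support hℓ hφ₁C hφ₁cs hφ₁supp
  have hS1 : L3 * ∑' n : {n : Fin 3 → ℤ // K' < ‖(fun j => (n j : ℝ))‖},
      (‖cellFourierCoeff ℓ φ₁ (n : Fin 3 → ℤ)‖₊ : ℝ≥0∞) ^ 2 ≤
      ENNReal.ofReal a * ∫⁻ x in cell ℓ, gradSqC φ₁ x := by
    have hw : ∀ n : Fin 3 → ℤ, ENNReal.ofReal ((∑ j, (n j : ℝ) ^ 2) / K' ^ 2) =
        ENNReal.ofReal a * ENNReal.ofReal (4 * Real.pi ^ 2 * (∑ j, (n j : ℝ) ^ 2) / ℓ ^ 2) := by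
      intro n
      rw [← ENNReal.ofReal_mul ha0]
      congr 1
      rw [ha]
      field_simp
    calc L3 * ∑' n : {n : Fin 3 → ℤ // K' < ‖(fun j => (n j : ℝ))‖},
          (‖cellFourierCoeff ℓ φ₁ (n : Fin 3 → ℤ)‖₊ : ℝ≥0∞) ^ 2
        ≤ L3 * ∑' n : Fin 3 → ℤ, ENNReal.ofReal ((∑ j, (n j : ℝ) ^ 2) / K' ^ 2) *
            (‖cellFourierCoeff ℓ φ₁ n‖₊ : ℝ≥0∞) ^ 2 :=
          mul_le_mul_right (tsum_tail_le_tsum_weight hK'pos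
            (fun n => (‖cellFourierCoeff ℓ φ₁ n‖₊ : ℝ≥0∞) ^ 2)) _
      _ = L3 * (ENNReal.ofReal a * ∑' n : Fin 3 → ℤ,
            ENNReal.ofReal (4 * Real.pi ^ 2 * (∑ j, (n j : ℝ) ^ 2) / ℓ ^ 2) *
              (‖cellFourierCoeff ℓ φ₁ n‖₊ : ℝ≥0∞) ^ 2) := by
          conv_rhs => rw [← ENNReal.tsum_mul_left]
          refine congrArg (L3 * ·) (tsum_congr fun n => ?_)
          rw [hw n, mul_assoc]
      _ = L3 * (ENNReal.ofReal a * (L3⁻¹ * ∫⁻ x in cell ℓ, gradSqC φ₁ x)) := by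
          rw [hcheb]; rfl
      _ = ENNReal.ofReal a * ∫⁻ x in cell ℓ, gradSqC φ₁ x := by
          rw [← mul_assoc, mul_comm L3, mul_assoc, ← mul_assoc L3, ENNReal.mul_inv_cancel hL3ne0
            hL3netop, one_mul]
  -- (3) the whole of `(1-χ)u`: Parseval
  have hS2 : L3 * ∑' n : {n : Fin 3 → ℤ // K' < ‖(fun j => (n j : ℝ))‖},
      (‖cellFourierCoeff ℓ φ₂ (n : Fin 3 → ℤ)‖₊ : ℝ≥0∞) ^ 2 ≤ COL := by
    have hpars := tsum_sq_cellFourierCoeff hℓ hφ₂C.continuous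
    calc L3 * ∑' n : {n : Fin 3 → ℤ // K' < ‖(fun j => (n j : ℝ))‖},
          (‖cellFourierCoeff ℓ φ₂ (n : Fin 3 → ℤ)‖₊ : ℝ≥0∞) ^ 2
        ≤ L3 * ∑' n : Fin 3 → ℤ, (‖cellFourierCoeff ℓ φ₂ n‖₊ : ℝ≥0∞) ^ 2 :=
          mul_le_mul_right (ENNReal.tsum_comp_le_tsum_of_injective Subtype.val_injective
            (fun n => (‖cellFourierCoeff ℓ φ₂ n‖₊ : ℝ≥0∞) ^ 2)) _
      _ = L3 * (L3⁻¹ * ∫⁻ x in cell ℓ, (‖φ₂ x‖₊ : ℝ≥0∞) ^ 2) := by rw [hpars]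
      _ = ∫⁻ x in cell ℓ, (‖φ₂ x‖₊ : ℝ≥0∞) ^ 2 := by
          rw [← mul_assoc, ENNReal.mul_inv_cancel hL3ne0 hL3netop, one_mul]
      _ ≤ COL := lintegral_sq_compl_cut_le h01 h1
  -- (4) kinetic energy of `χu` and (5) the collar mass
  have hG1 : ∫⁻ x in cell ℓ, gradSqC φ₁ x ≤
      2 * KIN + 2 * (ENNReal.ofReal (12 * Real.pi ^ 2 / s ^ 2) * COL) :=
    lintegral_gradSqC_cut_le hχ hχsupp h01 hD hin hu
  have hCOL : COL ≤ ENNReal.ofReal (12 / 336) * MASS + ENNReal.ofReal (4 * (336 + 1) * s ^ 2) * KIN :=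
    stub_collarMass ℓ s 336 hs0 (by norm_num) hroom u hu
  -- (6) the constants
  have hac : ENNReal.ofReal a * ENNReal.ofReal (12 * Real.pi ^ 2 / s ^ 2) = 3 := by
    rw [← ENNReal.ofReal_mul ha0, show a * (12 * Real.pi ^ 2 / s ^ 2) = 3 by
      rw [ha, hs]; field_simp; ring]
    norm_num
  have hc0 : (14 : ℝ≥0∞) * ENNReal.ofReal (12 / 336) = ENNReal.ofReal (1 / 2) := by
    rw [show (14 : ℝ≥0∞) = ENNReal.ofReal 14 by norm_num, ← ENNReal.ofReal_mul (by norm_num)]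
    congr 1; norm_num
  have hA : 4 * ENNReal.ofReal a + 14 * ENNReal.ofReal (4 * (336 + 1) * s ^ 2) =
      ENNReal.ofReal ((1 / Real.pi ^ 2 + 56 * 337) * (ℓ / K') ^ 2) := by
    rw [show (14 : ℝ≥0∞) = ENNReal.ofReal 14 by norm_num, show (4 : ℝ≥0∞) = ENNReal.ofReal 4 by
      norm_num, ← ENNReal.ofReal_mul (by norm_num), ← ENNReal.ofReal_mul (by norm_num),
      ← ENNReal.ofReal_add (by positivity) (by positivity)]
    congr 1
    rw [ha, hs]
    field_simp
    ring
  -- assembly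
  calc L3 * ∑' n : {n : Fin 3 → ℤ // K' < ‖(fun j => (n j : ℝ))‖},
        (‖cellFourierCoeff ℓ u (n : Fin 3 → ℤ)‖₊ : ℝ≥0∞) ^ 2
      ≤ L3 * ∑' n : {n : Fin 3 → ℤ // K' < ‖(fun j => (n j : ℝ))‖},
          (2 * (‖cellFourierCoeff ℓ φ₁ (n : Fin 3 → ℤ)‖₊ : ℝ≥0∞) ^ 2 +
            2 * (‖cellFourierCoeff ℓ φ₂ (n : Fin 3 → ℤ)‖₊ : ℝ≥0∞) ^ 2) :=
        mul_le_mul_right (ENNReal.tsum_le_tsum fun n => hcoef _) _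
    _ = 2 * (L3 * ∑' n : {n : Fin 3 → ℤ // K' < ‖(fun j => (n j : ℝ))‖},
          (‖cellFourierCoeff ℓ φ₁ (n : Fin 3 → ℤ)‖₊ : ℝ≥0∞) ^ 2) +
        2 * (L3 * ∑' n : {n : Fin 3 → ℤ // K' < ‖(fun j => (n j : ℝ))‖},
          (‖cellFourierCoeff ℓ φ₂ (n : Fin 3 → ℤ)‖₊ : ℝ≥0∞) ^ 2) := by
        rw [ENNReal.tsum_add, ENNReal.tsum_mul_left, ENNReal.tsum_mul_left]
        ring
    _ ≤ 2 * (ENNReal.ofReal a * ∫⁻ x in cell ℓ, gradSqC φ₁ x) + 2 * COL := by gcongr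
    _ ≤ 2 * (ENNReal.ofReal a * (2 * KIN + 2 * (ENNReal.ofReal (12 * Real.pi ^ 2 / s ^ 2) * COL))) +
        2 * COL := by gcongr
    _ = 4 * ENNReal.ofReal a * KIN +
        (4 * (ENNReal.ofReal a * ENNReal.ofReal (12 * Real.pi ^ 2 / s ^ 2)) + 2) * COL := by ring
    _ = 4 * ENNReal.ofReal a * KIN + 14 * COL := by rw [hac]; norm_num
    _ ≤ 4 * ENNReal.ofReal a * KIN +
        14 * (ENNReal.ofReal (12 / 336) * MASS + ENNReal.ofReal (4 * (336 + 1) * s ^ 2) * KIN) := by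
        gcongr
    _ = 14 * ENNReal.ofReal (12 / 336) * MASS +
        (4 * ENNReal.ofReal a + 14 * ENNReal.ofReal (4 * (336 + 1) * s ^ 2)) * KIN := by ring
    _ = ENNReal.ofReal (1 / 2) * MASS + ENNReal.ofReal ((1 / Real.pi ^ 2 + 56 * 337) * (ℓ / K') ^ 2) * KIN := by
        rw [hc0, hA]

end Summit.AtomisticToContinuum.BoseEinsteinCondensation.Theorems.BecUvTail

end
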